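import Summits.CriticalPhenomena.PercolationContinuityZ3.Theorems.PercNearOneGluingNoHeavyLowerTailKnQuestion8CoefficientwiseCoreClassKernelMixFull
import Summits.CriticalPhenomena.PercolationContinuityZ3.Theorems.PercNearOneGluingNoHeavyLowerTailKnQuestion8CoefficientwiseCoreClassKernelWrapper
import HarnessLib

/-!
# THEOREM TWO LEAVES from ANY domination map (KB-MIX-FULL)

Support file (`--supports stmt-CriticalPhenomena-4575`, closed), prover `prim-cplus-coupling` (gen 31).  No definitions, no notations, no named facts,
no sorries; standard axioms.  Memo `prim-cplus-coupling/A5-COUPLING-gen31.md` §1.4.  Same statement and proof as `…CoreClassKernelMixMain`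
(`cwpa_coreClass_of_leaf_leaf`), run with the FULL-supply invariant of `…CoreClassKernelMixFull`, so that the domination map of the middle graph
need not be proper: `dom ⟹ KB-MIX-FULL(E;a,b) ⟹ (leaf) ⟹ (symmetry) ⟹ (leaf) ⟹ (symmetry, equal levels) kernel of (a′a + E + bb′; a′, b′) ⟹ CW-PA`.
* `Coefficientwise.coreClass_kernel_nonneg_leaf_leaf_of_dom`, `Coefficientwise.cwpa_coreClass_of_leaf_leaf_of_dom`.
Relevance: domination maps exist (Hall, exact census) for every taut two-terminal graph on `≤ 7` vertices, proper ones fail for 48 of them at `n = 7`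
(memo §3); with this file the two pendant terminal edges may be hung on any of them.
[cite: KozmaNitzan2024, Questions 8–9 (§5.5 p. 36) (context: the Question-8 pocket covariance programme)]
-/

namespace Summit.CriticalPhenomena.PercolationContinuityZ3.Theorems

open Finset Literature.Probability.Percolation

namespace Coefficientwise

variable {ι V : Type*}

open Classical in
/-- **Two terminal leaves from ANY domination map: the kernel.**  Middle graph `E`, terminals `a, b`, a domination map `ψ` of `(E; a, b)` (injective on the wall event, `ψ ω ⊆ E`, `C_a ω ∪ C_b(E∖ω) ⊆ C_a(ψω) ∪ C_b(ψω)`; properness NOT required); new edges `e₁ ∉ E`,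
`e₂ ∉ insert e₁ E` with `ends e₁ = s(a′, a)`, `ends e₂ = s(b′, b)`, `a′` on no edge of `E`, `b′` on no edge of `insert e₁ E`, `a′ ≠ a, b`, `b′ ≠ b, a′`.
Then for every monotone `f` with `f ∅ = 0` and monotone `g`, with `E₂ = insert e₂ (insert e₁ E)`:
`0 ≤ Σ_{ω ⊆ E₂} f(C_{a′} ∪ C_{b′})(g(C_{a′} ∪ C_{b′}) − g ∅) + Σ_{ω : b′ ∉ C_{a′} ω, b′ ∉ C_{a′}(E₂∖ω)} [f(C_{a′} ω)(g(C_{a′} ω) − g(C_{b′}(E₂∖ω))) + f(C_{b′} ω)(g(C_{b′} ω) − g(C_{a′}(E₂∖ω)))]`.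
[cite: KozmaNitzan2024, Questions 8–9 (§5.5 p. 36) (context)] -/
theorem coreClass_kernel_nonneg_leaf_leaf_of_dom (ends : ι → Sym2 V) (E : Finset ι) (e₁ e₂ : ι) (a a' b b' : V)
    (he₁ : e₁ ∉ E) (he₂ : e₂ ∉ insert e₁ E) (hends₁ : ends e₁ = s(a', a)) (hends₂ : ends e₂ = s(b', b))
    (ha'E : ∀ i ∈ E, a' ∉ ends i) (hb'E : ∀ i ∈ insert e₁ E, b' ∉ ends i)
    (ha'a : a' ≠ a) (ha'b : a' ≠ b) (hb'b : b' ≠ b) (hb'a' : b' ≠ a')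
    (ψ : Finset ι → Finset ι)
    (hψE : ∀ ω, ω ⊆ E → b ∉ openCluster (ends '' (↑ω : Set ι)) a → b ∉ openCluster (ends '' (↑(E \ ω) : Set ι)) a → ψ ω ⊆ E)
    (hψcov : ∀ ω, ω ⊆ E → b ∉ openCluster (ends '' (↑ω : Set ι)) a → b ∉ openCluster (ends '' (↑(E \ ω) : Set ι)) a →
      openCluster (ends '' (↑ω : Set ι)) a ∪ openCluster (ends '' (↑(E \ ω) : Set ι)) b ⊆
        openCluster (ends '' (↑(ψ ω) : Set ι)) a ∪ openCluster (ends '' (↑(ψ ω) : Set ι)) b)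
    (hψinj : ∀ ω₁ ω₂, ω₁ ⊆ E → b ∉ openCluster (ends '' (↑ω₁ : Set ι)) a → b ∉ openCluster (ends '' (↑(E \ ω₁) : Set ι)) a →
      ω₂ ⊆ E → b ∉ openCluster (ends '' (↑ω₂ : Set ι)) a → b ∉ openCluster (ends '' (↑(E \ ω₂) : Set ι)) a → ψ ω₁ = ψ ω₂ → ω₁ = ω₂)
    (f g : Set V → ℝ) (hf : Monotone f) (hf0 : f ∅ = 0) (hg : Monotone g) :
    0 ≤ (∑ ω ∈ (insert e₂ (insert e₁ E)).powerset,
        f (openCluster (ends '' (↑ω : Set ι)) a' ∪ openCluster (ends '' (↑ω : Set ι)) b') *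
          (g (openCluster (ends '' (↑ω : Set ι)) a' ∪ openCluster (ends '' (↑ω : Set ι)) b') - g ∅))
      + ∑ ω ∈ (insert e₂ (insert e₁ E)).powerset.filter (fun ω : Finset ι => b' ∉ openCluster (ends '' (↑ω : Set ι)) a' ∧
            b' ∉ openCluster (ends '' (↑((insert e₂ (insert e₁ E)) \ ω) : Set ι)) a'),
        (f (openCluster (ends '' (↑ω : Set ι)) a') *
            (g (openCluster (ends '' (↑ω : Set ι)) a') - g (openCluster (ends '' (↑((insert e₂ (insert e₁ E)) \ ω) : Set ι)) b'))
          + f (openCluster (ends '' (↑ω : Set ι)) b') *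
            (g (openCluster (ends '' (↑ω : Set ι)) b') - g (openCluster (ends '' (↑((insert e₂ (insert e₁ E)) \ ω) : Set ι)) a'))) := by
  set C : Finset ι → V → Set V := fun ω v => openCluster (ends '' (↑ω : Set ι)) v with hC
  set E₁ : Finset ι := insert e₁ E with hE₁
  set E₂ : Finset ι := insert e₂ E₁ with hE₂
  -- stage 1: KB-MIX for (E₁; a', b) at all levels
  have s1 : ∀ h k ha hb ka kb : Set V → ℝ, Monotone h → Monotone k → Monotone ha → Monotone hb → Monotone ka → Monotone kb →
      (∀ X, 0 ≤ ha X) → (∀ X, ha X ≤ h X) → (∀ X, 0 ≤ hb X) → (∀ X, hb X ≤ h X) →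
      (∀ X, 0 ≤ ka X) → (∀ X, ka X ≤ k X) → (∀ X, 0 ≤ kb X) → (∀ X, kb X ≤ k X) →
      0 ≤ (∑ ω ∈ E₁.powerset, h (C ω a' ∪ C ω b) * k (C ω a' ∪ C ω b))
        + ∑ ω ∈ E₁.powerset.filter (fun ω : Finset ι => b ∉ C ω a' ∧ b ∉ C (E₁ \ ω) a'),
          (ha (C ω a') - hb (C (E₁ \ ω) b)) * (ka (C ω a') - kb (C (E₁ \ ω) b)) := by
    intro h k ha hb ka kb hh hk mha mhb mka mkb ha0 hah hb0 hbh ka0 kak kb0 kbk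
    refine coreClass_kernelMixFull_leaf ends E e₁ a a' b he₁ hends₁ ha'E ha'a ha'b h k ha hb ka kb hh hk mha mhb mka mkb
      ha0 hah hb0 hbh ka0 kak kb0 kbk ?_
    exact coreClass_kernelMixFull_of_dom ends E a b (fun X => h (insert a' X)) (fun X => k (insert a' X))
      (fun X => ha (insert a' X)) hb (fun X => ka (insert a' X)) kb
      (fun X Y hXY => hh (Set.insert_subset_insert hXY)) (fun X Y hXY => hk (Set.insert_subset_insert hXY))
      (fun X => ha0 _) (fun X => hah _) (fun X => hb0 _) (fun X => le_trans (hbh X) (hh (Set.subset_insert _ _)))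
      (fun X => ka0 _) (fun X => kak _) (fun X => kb0 _) (fun X => le_trans (kbk X) (hk (Set.subset_insert _ _)))
      ψ hψE hψcov hψinj
  -- stage 2: KB-MIX for (E₁; b, a') at all levels (terminal symmetry)
  have s2 : ∀ h k ha hb ka kb : Set V → ℝ, Monotone h → Monotone k → Monotone ha → Monotone hb → Monotone ka → Monotone kb →
      (∀ X, 0 ≤ ha X) → (∀ X, ha X ≤ h X) → (∀ X, 0 ≤ hb X) → (∀ X, hb X ≤ h X) →
      (∀ X, 0 ≤ ka X) → (∀ X, ka X ≤ k X) → (∀ X, 0 ≤ kb X) → (∀ X, kb X ≤ k X) →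
      0 ≤ (∑ ω ∈ E₁.powerset, h (C ω b ∪ C ω a') * k (C ω b ∪ C ω a'))
        + ∑ ω ∈ E₁.powerset.filter (fun ω : Finset ι => a' ∉ C ω b ∧ a' ∉ C (E₁ \ ω) b),
          (ha (C ω b) - hb (C (E₁ \ ω) a')) * (ka (C ω b) - kb (C (E₁ \ ω) a')) := by
    intro h k ha hb ka kb hh hk mha mhb mka mkb ha0 hah hb0 hbh ka0 kak kb0 kbk
    rw [coreClass_kernelMixFull_comm ends E₁ a' b h k hb ha kb ka]
    exact s1 h k hb ha kb ka hh hk mhb mha mkb mka hb0 hbh ha0 hah kb0 kbk ka0 kak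
  -- stage 3: KB-MIX for (E₂; b', a') at all levels (leaf at b)
  have s3 : ∀ h k ha hb ka kb : Set V → ℝ, Monotone h → Monotone k → Monotone ha → Monotone hb → Monotone ka → Monotone kb →
      (∀ X, 0 ≤ ha X) → (∀ X, ha X ≤ h X) → (∀ X, 0 ≤ hb X) → (∀ X, hb X ≤ h X) →
      (∀ X, 0 ≤ ka X) → (∀ X, ka X ≤ k X) → (∀ X, 0 ≤ kb X) → (∀ X, kb X ≤ k X) →
      0 ≤ (∑ ω ∈ E₂.powerset, h (C ω b' ∪ C ω a') * k (C ω b' ∪ C ω a'))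
        + ∑ ω ∈ E₂.powerset.filter (fun ω : Finset ι => a' ∉ C ω b' ∧ a' ∉ C (E₂ \ ω) b'),
          (ha (C ω b') - hb (C (E₂ \ ω) a')) * (ka (C ω b') - kb (C (E₂ \ ω) a')) := by
    intro h k ha hb ka kb hh hk mha mhb mka mkb ha0 hah hb0 hbh ka0 kak kb0 kbk
    refine coreClass_kernelMixFull_leaf ends E₁ e₂ b b' a' he₂ hends₂ hb'E hb'b hb'a' h k ha hb ka kb hh hk mha mhb mka mkb
      ha0 hah hb0 hbh ka0 kak kb0 kbk ?_
    exact s2 (fun X => h (insert b' X)) (fun X => k (insert b' X)) (fun X => ha (insert b' X)) hb (fun X => ka (insert b' X)) kb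
      (fun X Y hXY => hh (Set.insert_subset_insert hXY)) (fun X Y hXY => hk (Set.insert_subset_insert hXY))
      (fun X Y hXY => mha (Set.insert_subset_insert hXY)) mhb (fun X Y hXY => mka (Set.insert_subset_insert hXY)) mkb
      (fun X => ha0 _) (fun X => hah _) (fun X => hb0 _) (fun X => le_trans (hbh X) (hh (Set.subset_insert _ _)))
      (fun X => ka0 _) (fun X => kak _) (fun X => kb0 _) (fun X => le_trans (kbk X) (hk (Set.subset_insert _ _)))
  -- stage 4: back to (E₂; a', b') at equal levels, then the kernel
  have hf_nonneg : ∀ X : Set V, 0 ≤ f X := fun X => by rw [← hf0]; exact hf (Set.empty_subset X)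
  have hg' : Monotone (fun X : Set V => g X - g ∅) := fun X Y hXY => sub_le_sub_right (hg hXY) _
  have hg0 : ∀ X : Set V, 0 ≤ g X - g ∅ := fun X => sub_nonneg.mpr (hg (Set.empty_subset X))
  have s4 : 0 ≤ (∑ ω ∈ E₂.powerset,
        f (C ω a' ∪ C ω b') * (g (C ω a' ∪ C ω b') - g ∅))
      + ∑ ω ∈ E₂.powerset.filter (fun ω : Finset ι => b' ∉ C ω a' ∧ b' ∉ C (E₂ \ ω) a'),
        (f (C ω a') - f (C (E₂ \ ω) b')) * ((g (C ω a') - g ∅) - (g (C (E₂ \ ω) b') - g ∅)) := by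
    rw [← coreClass_kernelMixFull_comm ends E₂ a' b' f (fun X : Set V => g X - g ∅) f f (fun X : Set V => g X - g ∅) (fun X : Set V => g X - g ∅)]
    exact s3 f (fun X : Set V => g X - g ∅) f f (fun X : Set V => g X - g ∅) (fun X : Set V => g X - g ∅) hf hg' hf hf hg' hg'
      hf_nonneg (fun X => le_refl _) hf_nonneg (fun X => le_refl _) hg0 (fun X => le_refl _) hg0 (fun X => le_refl _)
  exact coreClass_kernel_nonneg_of_kernelMixFull ends E₂ a' b' f g s4

open Classical in
/-- **THEOREM TWO LEAVES (any domination map) — CW-PA on the core class `N(x) = N(z) = {a′, b′}` over `a′a + H + bb′`.**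
Core-class bookkeeping for the middle graph `E₂ = insert e₂ (insert e₁ E_H)` (terminals `a′, b′`, joined to `x` and `z` by `ixa, ixb, iza, izb`, no edge of
`E₂` at `x, z`); `e₁ = a′a ∉ E_H`, `e₂ = b′b ∉ insert e₁ E_H`, `a′` on no edge of `E_H`, `b′` on no edge of `insert e₁ E_H`, `a′ ≠ a, b`, `b′ ≠ b, a′`; a
domination map `ψ` of `(E_H; a, b)` (not necessarily proper).  Then for all monotone `f, g`: `0 ≤ Σ_{s ⊆ E₀ : z ∉ C_x(s), z ∉ C_x(E₀∖s)} f(C_x s)·(g(C_x s) − g(C_x(E₀∖s)))`.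
[cite: KozmaNitzan2024, Questions 8–9 (§5.5 p. 36) (context)] -/
theorem cwpa_coreClass_of_leaf_leaf_of_dom (ends : ι → Sym2 V) (EH E₀ : Finset ι) (x z a a' b b' : V) (e₁ e₂ ixa ixb iza izb : ι)
    (he₁ : e₁ ∉ EH) (he₂ : e₂ ∉ insert e₁ EH) (hends₁ : ends e₁ = s(a', a)) (hends₂ : ends e₂ = s(b', b))
    (ha'E : ∀ i ∈ EH, a' ∉ ends i) (hb'E : ∀ i ∈ insert e₁ EH, b' ∉ ends i)
    (ha'a : a' ≠ a) (ha'b : a' ≠ b) (hb'b : b' ≠ b) (hb'a' : b' ≠ a')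
    (hxa : ends ixa = s(x, a')) (hxb : ends ixb = s(x, b')) (hza : ends iza = s(z, a')) (hzb : ends izb = s(z, b'))
    (hH : ∀ i ∈ insert e₂ (insert e₁ EH), x ∉ ends i ∧ z ∉ ends i)
    (hE₀ : ∀ i, i ∈ E₀ ↔ i ∈ insert e₂ (insert e₁ EH) ∨ i = ixa ∨ i = ixb ∨ i = iza ∨ i = izb)
    (hnot : ixa ∉ insert e₂ (insert e₁ EH) ∧ ixb ∉ insert e₂ (insert e₁ EH) ∧ iza ∉ insert e₂ (insert e₁ EH) ∧ izb ∉ insert e₂ (insert e₁ EH))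
    (hd : ixa ≠ ixb ∧ ixa ≠ iza ∧ ixa ≠ izb ∧ ixb ≠ iza ∧ ixb ≠ izb ∧ iza ≠ izb)
    (hxz : x ≠ z) (hxa' : x ≠ a') (hxb' : x ≠ b') (hza' : z ≠ a') (hzb' : z ≠ b')
    (ψ : Finset ι → Finset ι)
    (hψE : ∀ ω, ω ⊆ EH → b ∉ openCluster (ends '' (↑ω : Set ι)) a → b ∉ openCluster (ends '' (↑(EH \ ω) : Set ι)) a → ψ ω ⊆ EH)
    (hψcov : ∀ ω, ω ⊆ EH → b ∉ openCluster (ends '' (↑ω : Set ι)) a → b ∉ openCluster (ends '' (↑(EH \ ω) : Set ι)) a →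
      openCluster (ends '' (↑ω : Set ι)) a ∪ openCluster (ends '' (↑(EH \ ω) : Set ι)) b ⊆
        openCluster (ends '' (↑(ψ ω) : Set ι)) a ∪ openCluster (ends '' (↑(ψ ω) : Set ι)) b)
    (hψinj : ∀ ω₁ ω₂, ω₁ ⊆ EH → b ∉ openCluster (ends '' (↑ω₁ : Set ι)) a → b ∉ openCluster (ends '' (↑(EH \ ω₁) : Set ι)) a →
      ω₂ ⊆ EH → b ∉ openCluster (ends '' (↑ω₂ : Set ι)) a → b ∉ openCluster (ends '' (↑(EH \ ω₂) : Set ι)) a → ψ ω₁ = ψ ω₂ → ω₁ = ω₂)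
    (f g : Set V → ℝ) (hf : Monotone f) (hg : Monotone g) :
    0 ≤ ∑ s ∈ E₀.powerset.filter (fun s : Finset ι => z ∉ openCluster (ends '' (↑s : Set ι)) x ∧ z ∉ openCluster (ends '' (↑(E₀ \ s) : Set ι)) x),
      f (openCluster (ends '' (↑s : Set ι)) x) * (g (openCluster (ends '' (↑s : Set ι)) x) - g (openCluster (ends '' (↑(E₀ \ s) : Set ι)) x)) :=
  cwpa_coreClass_of_kernel ends (insert e₂ (insert e₁ EH)) E₀ x z a' b' ixa ixb iza izb hxa hxb hza hzb hH hE₀ hnot hd hxz hxa' hxb' hza' hzb'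
    (fun f' g' hf' hf0' hg' => coreClass_kernel_nonneg_leaf_leaf_of_dom ends EH e₁ e₂ a a' b b' he₁ he₂ hends₁ hends₂ ha'E hb'E ha'a ha'b hb'b hb'a'
      ψ hψE hψcov hψinj f' g' hf' hf0' hg') f g hf hg

end Coefficientwise

end Summit.CriticalPhenomena.PercolationContinuityZ3.Theorems
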